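import Summits.BirchSwinnertonDyer.BirchSwinnertonDyer.Theses.PrintX10b
import Summits.BirchSwinnertonDyer.BirchSwinnertonDyer.Theorems.PrintX9StabilizedClassOfKolyvaginSystemLeaf
import Summits.BirchSwinnertonDyer.BirchSwinnertonDyer.Theorems.PrintX10bHowardContainmentAnyClassNumberX10bThm413Hyp
import Literature.NumberTheory.EllipticCurves.CastellaGrossiSkinner2025.HeegnerKolyvaginBoundAnyClassNumberProofs
import Literature.NumberTheory.EllipticCurves.HeegnerCharIdealEnvelopeProofs
import Literature.NumberTheory.EllipticCurves.HeegnerCharIdealEnvelopePowTransferProofs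
import Literature.NumberTheory.EllipticCurves.IwasawaAlgebraPromotionProofs
import Literature.NumberTheory.EllipticCurves.HeegnerGeomCoherentDataOfFrameProofs
import Literature.NumberTheory.EllipticCurves.AnticyclotomicTowerSharpProofs
import Literature.NumberTheory.EllipticCurves.MatarNekovar2019.IrreducibleOverQuadraticFieldProofs
import Literature.NumberTheory.EllipticCurves.HeegnerHypothesisKroneckerProofs
import HarnessLib

/-!
# Row 10's A-side WITHOUT the leaf `CGLSHeegnerClassNonvanishing` (27103): the pinned light containment
# `HowardContainmentLightFrameX10bPinned` (27274) and the deciding crux `HowardContainmentLightFrameX10bPinnedOfPrint` (27275)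
# from the Kolyvagin-system leaf (F-411), Howard's DVR bound (F-161), Mastella–Zerman Cor. 4.6 and CGS Thm. 6.5.2 — plus
# the BROAD pinned aside 26621 restricted to odd `d_K`

Cell `pub/bsd-print-x9`, seat `bsd-line-x10b-p2` (LEAD g11; write-crux stmt-BirchSwinnertonDyer-23729, lineage 27275); the
X10b TWIN asked for by the x9-p1 LEAD (g7, 2026-08-29T02:19Z «hNV-ELIMINABLE … the X10b twin — yours if you want it») of
his row-9 re-plumbing over the route-free core `HeegnerStabilizedOfKSLeaf` (`PrintX9StabilizedClassOfKolyvaginSystemLeaf`).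
THEOREMS ONLY; `--supports` (helper); no `closes` change is made here (the pen decides).

THE POINT. In `PrintX10b.closes` the A-side sub-term reads `hG hM hH hK hCG hMZ hNV hCGS hTw : HowardContainmentLightFrameX10bPinned`.
Of these, `hCG` (Greenberg LNM 1716 Prop. 2.4) left the load path when the round-2 μ-crux 23237 `MuInequalityCoherentPairOfPrint`
closed (CG-FRAME road, p687364), `hTw` (27076) is the THEOREM `anticyclotomicTowerSharp`, and `hNV` (CGLS 2022 Thm. 4.1.1 with
its `∀ C` typing, leaf 27103) is used by every row-10 closer ONLY to know that `𝔖/Λκ_∞(C₀)` is torsion at the engine's coherent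
datum `C₀` — which the Kolyvagin-system leaf `hK` (F-411, `CGLSHeegnerKolyvaginSystem`, ALREADY a `closes` binder) gives at the
engine's class `κ_∞` together with `Λ`-rank one of `𝔖` (from `hCGS`) and the kernel's torsion-freeness of `𝔖`
(`HeegnerStabilizedOfKSLeaf.torsionFree_and_isTorsion_quotient_of_kolyvaginSystemLeaf`, x9-p1 LEAD g7). Hence:

* §1 `pinnedContainment_oddDisc_at_of_howard_kolyvaginSystem_mz_cgs` — for a GIVEN `jbar`, on every X10b Heegner frame with
  `d_K` odd, `≠ -3`, (irr_K): `∃ D F X, F.Dt = Dt ∧ I(ℋ_∞(F))² ⊆ char_Λ(X_tors)` from `hH hK hMZ hCGS`. `3 ∤ h_K`: MZ26 Cor. 4.6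
  (`X10.heegnerContainmentPinned_of_cor46_of_not_surj`). `3 ∣ h_K`: the strengthened coherent-pair letter
  `HeegnerStabilizedOfKSLeaf.exists_coherentPair_isTorsion_muIneq_of_howard_kolyvaginSystem` (F-161 + F-411: coherent pair `(C, F)`
  on `(Dt, H.β)`, envelopes, and — from `Λ`-rank one — torsion-freeness, torsion of `𝔖/Λκ_∞(C)` and the μ-inequality
  `length_(3)(X_tors) ≤ 2·length_(3)(𝔖/Λκ_∞(C))`), `Λ`-rank one + finiteness + `(3^m)·I(Λκ_∞(C))² ⊆ char` from CGS Thm. 6.5.2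
  (`hCGS`), the promotion `IwasawaAlgebra.sq_charIdeal_le_charIdeal_of_span_p_pow_mul_le_of_lengthAt_le_two_mul` (x10b-p1,
  p613811), then `I(ℋ_F) ≤ I(Λκ_C)` along the envelope — VERBATIM the proof of my lineage's
  `PrintX10bSharpMuCoherentPair.howardContainmentLightFrameX10bPinnedOfPrint_of_muPartStabilizedCoherentPair` with the L∃ letter
  replaced by the strengthened one. NO rank / `Ш` binder is used.
* §2 `howardContainmentLightFrameX10bPinned_of_howard_kolyvaginSystem_mz_cgs :
  HowardDVRKolyvaginBound → CGLSHeegnerKolyvaginSystem → MastellaZermanHowardDivisibility → CGSHowardDivisibilityPLocalized →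
  HowardContainmentLightFrameX10bPinned` (27274 from FOUR `closes` binders) and
  `howardContainmentLightFrameX10bPinnedOfPrint_of_howard_kolyvaginSystem :
  HowardDVRKolyvaginBound → CGLSHeegnerKolyvaginSystem → HowardContainmentLightFrameX10bPinnedOfPrint` (the deciding crux 27275
  BY NAME; of its own binders `hNV`, `hTw` are idle) — so the sub-term above can read `(§2) hH hK hMZ hCGS`.
* (sibling display module `PrintX10bCornerOfKolyvaginSystemLeaf`: the row-10 corner `WAllCornerX10b` and the leaf
  `X10.BSDpOnClassX10b` from SEVEN cite-only binders through the closed doors — kept out of this file so that the containments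
  import no by-name closer of the route.)
* §3 (this seat's own lineage) the BROAD pinned aside `HowardContainmentAnyClassNumberX10bPinned` (26621, PIN-1 twin of the
  write-crux 23729) RESTRICTED TO ODD `d_K`, at ANY Selmer corank and ANY class number, from the same four binders —
  `howardContainmentAnyClassNumberX10bPinned_oddDisc_of_howard_kolyvaginSystem_mz_cgs`: the light binders (rank one, `Ш[3^∞]`
  finite) of 27274 are idle in §1, and (irr_K) follows from (irr_ℚ) on a Heegner frame (Matar–Nekovář Prop. 5.26 (2),
  `hasIrreducibleModPGaloisRep_baseChange_of_coprime`, with `(N_E, d_K) = 1` from (Heeg)). Its even-`d_K` half at `3 ∣ h_K` has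
  no printed source (CGLS (disc)), exactly as for 23729 (census evidence #44).

HONEST FRAMING. Every theorem here is CONDITIONAL on cite-only print leaves that are ALREADY binders of `PrintX10b.closes`
(statement-only Literature facts, policed REF-131/132/136/137); what changes is the trust base a pen MAY record for row 10:
{F-161, F-411, hMZ, hCGS, hPT, hHP, hP} instead of the ten of the booked display. No route verb from this seat. No summit
statement is proved; BSD is NOT proved by this file or by anything it imports; «beyond-print theorem»: no.

References: [Howard2004HeegnerKolyvagin] Thm. 1.6.1, Thm. 2.2.10, §3.3; [CastellaGrossiLeeSkinner2022] Thm. 4.1.1, Rem. 4.1.4,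
§3.2/§4.1; [CastellaGrossiSkinner2025] Thm. 6.5.2; [MastellaZerman2026] Cor. 4.6; [LombardoTronto2022] Prop. 3.12;
[MatarNekovar2019] Prop. 5.26 (2); [PerrinRiou1987BSMF] §1, §3.4; [Washington1997] §13.2.
-/

set_option linter.dupNamespace false
set_option autoImplicit false

noncomputable section

open scoped Classical Pointwise
open Literature Literature.NumberTheory.EllipticCurves WeierstrassCurve
  Literature.NumberTheory.EllipticCurves.ModularForms
  Literature.NumberTheory.EllipticCurves.CastellaGrossiLeeSkinner2022
  Literature.NumberTheory.GaloisCohomology.Howard2004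
open Literature.NumberTheory.EllipticCurves.Rank1Residual (ClassX10 Surj)
open Summit.BirchSwinnertonDyer.BirchSwinnertonDyer.Theses.PrintX10b
  (HowardDVRKolyvaginBound CGLSHeegnerKolyvaginSystem MastellaZermanHowardDivisibility CGLSHeegnerClassNonvanishing
    CGSHowardDivisibilityPLocalized AnticyclotomicTowerSharp HowardContainmentLightFrameX10bPinned
    HowardContainmentLightFrameX10bPinnedOfPrint PinnedTransferPrintFacts HeegnerPrintFactsX10b PrintFactsX10b
    HowardContainmentAnyClassNumberX10bPinned)
open Summit.BirchSwinnertonDyer.BirchSwinnertonDyer.Theorems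

namespace Summit.BirchSwinnertonDyer.BirchSwinnertonDyer.Theorems.PrintX10bOfKSLeaf

/-! ## §1 The pinned containment for a GIVEN `jbar` on an odd-`d_K` X10b frame, from `hH hK hMZ hCGS` -/

/-- **The PINNED Howard containment on an odd-`d_K` X10b Heegner frame with (irr_K), for a given `jbar`, from Howard 2004
Thm. 1.6.1 (`HowardDVRKolyvaginBound`), the Kolyvagin-system leaf CGLS 2022 Thm. 4.1.1 (`CGLSHeegnerKolyvaginSystem`),
Mastella–Zerman 2026 Cor. 4.6 (`MastellaZermanHowardDivisibility`) and CGS 2025 Thm. 6.5.2 (`CGSHowardDivisibilityPLocalized`)**: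
`∃ D F X, F.Dt = Dt ∧ I(ℋ_∞(F))² ⊆ char_Λ(X_{Λ-tors})` — ANY class number, ANY Selmer corank (no rank / `Ш` binder).
`3 ∤ h_K`: MZ26 Cor. 4.6 at `3` (scalar image by Lombardo–Tronto 3.12). `3 ∣ h_K`: the strengthened coherent-pair letter
(`HeegnerStabilizedOfKSLeaf.exists_coherentPair_isTorsion_muIneq_of_howard_kolyvaginSystem`: torsion and the μ-inequality
DERIVED from `Λ`-rank one), `Λ`-rank one / finiteness / `(3^m)·I(Λκ_∞(C))² ⊆ char` from Thm. 6.5.2, x10b-p1's μ-promotion,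
and `I(ℋ_F) ≤ I(Λκ_C)` along the envelope; the tower input is the THEOREM `anticyclotomicTowerSharp`.
[cite: Howard2004HeegnerKolyvagin, Thm. 1.6.1 and proof of Thm. 2.2.10] [cite: CastellaGrossiLeeSkinner2022, Thm. 4.1.1, Rem. 4.1.4]
[cite: CastellaGrossiSkinner2025, Thm. 6.5.2] [cite: MastellaZerman2026, Cor. 4.6] [cite: LombardoTronto2022, Prop. 3.12]
[cite: Washington1997, §13.2] -/
theorem pinnedContainment_oddDisc_at_of_howard_kolyvaginSystem_mz_cgs
    (hH : HowardDVRKolyvaginBound) (hK : CGLSHeegnerKolyvaginSystem) (hMZ : MastellaZermanHowardDivisibility)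
    (hCGS : CGSHowardDivisibilityPLocalized)
    {W : WeierstrassCurve ℚ} [W.IsElliptic] [W.IsGloballyMinimal] {p : ℕ} [Fact p.Prime]
    [NeZero (W.conductorNorm ℤ)] {K : Type} [Field K] [NumberField K]
    (hX : ClassX10 W p) (hns : ¬ Surj W 3) (hcm : ¬ W.HasCM) (hKq : IsImaginaryQuadratic K)
    (hodd : Odd (NumberField.discr K)) (h3 : NumberField.discr K ≠ -3)
    (hHN : SatisfiesHeegnerHypothesis (W.conductorNorm ℤ) K) (hHp : SatisfiesHeegnerHypothesis p K)
    (hirr : (W.baseChange K).HasIrreducibleModPGaloisRep p)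
    {κ : ZpExtension K p} (hκ : κ.IsAnticyclotomic) {γ : Field.absoluteGaloisGroup K} (hγ : κ.IsTopGenerator γ)
    (Dt : ModularParametrizationData W (W.conductorNorm ℤ))
    (H : HeegnerDatum (W.conductorNorm ℤ) (NumberField.discr K)) (jbar : AlgebraicClosure K →+* ℂ) :
    ∃ (D : (W.baseChange K).LambdaAdicSelmerData κ γ) (F : HeegnerFamily (W.conductorNorm ℤ) W K κ jbar)
      (X : (W.baseChange K).SelmerDualData κ γ),
      F.Dt = Dt ∧ heegnerCharIdeal D F ^ 2 ≤
        Module.charIdeal (IwasawaAlgebra p) (Submodule.torsion (IwasawaAlgebra p) X.X) := by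
  have hp : p.Prime := Fact.out
  by_cases hhK : p ∣ NumberField.classNumber K
  · obtain ⟨D⟩ := LambdaAdicSelmerDataExists.nonempty_lambdaAdicSelmerData (W.baseChange K) p κ hγ
    obtain ⟨X⟩ := (W.baseChange K).nonempty_selmerDualData_holds κ γ hγ
    have hyp := Summit.BirchSwinnertonDyer.BirchSwinnertonDyer.Rank1Residual.X10.thm413Hypotheses_of_classX10
      hX hKq h3 hHN hHp hodd hκ hγ
    have hirrQ : W.HasIrreducibleModPGaloisRep p := by
      obtain ⟨rfl, -⟩ := id hX
      exact hX.irr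
    have hTw1 : ∀ k : ℕ, ringClassSubgroup K (p ^ (k + 1)) jbar ≤ κ.layerSubgroup k :=
      fun k ↦ anticyclotomicTowerSharp K p (hp.odd_of_ne_two hX.ne_two) hKq κ hκ jbar k
    -- the two Howard-side leaves, by name
    have h161 : thm161_dvrKolyvaginBound := hH
    have hKS : thm411_exists_kolyvaginSystem_one_ne_zero := hK
    -- the strengthened coherent-pair letter at `(Dt, H.β, D, X)`: pair, envelopes, torsion and μ from rank one
    obtain ⟨C, F, -, hFDt, -, -, hle, ⟨g, hg, hrev⟩, htf, hμC⟩ :=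
      HeegnerStabilizedOfKSLeaf.exists_coherentPair_isTorsion_muIneq_of_howard_kolyvaginSystem h161 hKS
        (W.conductorNorm ℤ) W K p κ γ jbar hyp hcm hirrQ hirr
        (Rank1Residual.ClassX10.hasPadicScalarImage_of_not_surj hX hns) hHp hhK hX.not_dvd_conductorNorm hTw1
        (card_ringClassGalOver_prime_one_of_frame hKq hodd h3 hp hHp jbar) Dt H.β H.dvd_sq_sub D X
    -- CGS Thm. 6.5.2 BY NAME at `(D, C, X)`: finiteness, `Λ`-rank one, the p-localized bound in C-currency
    have h652 : CastellaGrossiSkinner2025.thm652_stabilized_rankOne_charIdeal_torsion_dvd_pLocalized.{0} := hCGS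
    obtain ⟨⟨hfinS, hS1⟩, hfinX, -⟩ := h652 (W.conductorNorm ℤ) W K p κ γ jbar hyp D C X
    haveI := hfinS
    haveI := hfinX
    obtain ⟨hfree, htorC⟩ := htf hfinS hS1
    haveI := hfree
    obtain ⟨m, hm⟩ := CastellaGrossiSkinner2025.span_pow_mul_sq_le_charIdeal_torsion_of_thm652_stabilized h652
      hyp D C X
    -- the μ-inequality at `C` (derived from rank one) promotes the p-localized bound (x10b-p1's promotion, p613811)
    haveI : IsNoetherian (IwasawaAlgebra p) X.X := isNoetherian_of_isNoetherianRing_of_finite _ _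
    haveI : Module.Finite (IwasawaAlgebra p) (Submodule.torsion (IwasawaAlgebra p) X.X) := inferInstance
    haveI : Module.Finite (IwasawaAlgebra p) (D.S ⧸ stabilizedHeegnerModule D C) := inferInstance
    have hsqC : stabilizedHeegnerCharIdeal D C ^ 2 ≤
        Module.charIdeal (IwasawaAlgebra p) (Submodule.torsion (IwasawaAlgebra p) X.X) := by
      rw [stabilizedHeegnerCharIdeal_def] at hm ⊢
      exact IwasawaAlgebra.sq_charIdeal_le_charIdeal_of_span_p_pow_mul_le_of_lengthAt_le_two_mul
        (Submodule.torsion_isTorsion (R := IwasawaAlgebra p) (M := X.X)) htorC (hμC hfinS hfinX hS1) hm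
    -- torsion of `𝔖/ℋ_F` from the reverse inclusion, then `I(ℋ_F) ≤ I(Λκ_C)` from the forward inclusion
    have htor : Module.IsTorsion (IwasawaAlgebra p) (D.S ⧸ heegnerModule D F) :=
      isTorsion_quotient_heegnerModule_of_smul_stabilizedHeegnerModule_le D F C hg hrev htorC
    have hIF : heegnerCharIdeal D F ≤ stabilizedHeegnerCharIdeal D C :=
      heegnerCharIdeal_le_stabilizedHeegnerCharIdeal_of_le D F C htor hle
    exact ⟨D, F, X, hFDt, (Ideal.pow_right_mono hIF 2).trans hsqC⟩
  · have h46 : MastellaZerman2026.cor46_howardDivisibility_of_scalarImage.{0} := hMZ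
    obtain ⟨D, F, X, hFD, -, hle⟩ :=
      Summit.BirchSwinnertonDyer.BirchSwinnertonDyer.Rank1Residual.X10.heegnerContainmentPinned_of_cor46_of_not_surj
        h46 hX hns hcm hKq h3 (hKq.discr_lt_neg_four_of_odd hodd h3).ne hHN hHp hhK κ hκ γ hγ Dt H jbar
    exact ⟨D, F, X, hFD, hle⟩

/-! ## §2 The light pinned containment (27274) and the deciding crux (27275) WITHOUT `hNV` -/

/-- **`HowardContainmentLightFrameX10bPinned` (stmt-BirchSwinnertonDyer-27274) from FOUR `closes` binders — `hH`, `hK`, `hMZ`,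
`hCGS`** (no `CGLSHeegnerClassNonvanishing`, no `AnticyclotomicTowerSharp` binder, no `CoatesGreenbergKummerImage`, no
μ-letter): §1 with `jbar := IsAlgClosed.lift` along `ιC`; the light binders `hc`, `hrk`, `hfin` are idle.
[cite: Howard2004HeegnerKolyvagin, Thm. 1.6.1] [cite: CastellaGrossiLeeSkinner2022, Thm. 4.1.1] [cite: CastellaGrossiSkinner2025, Thm. 6.5.2]
[cite: MastellaZerman2026, Cor. 4.6] -/
theorem howardContainmentLightFrameX10bPinned_of_howard_kolyvaginSystem_mz_cgs
    (hH : HowardDVRKolyvaginBound) (hK : CGLSHeegnerKolyvaginSystem) (hMZ : MastellaZermanHowardDivisibility)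
    (hCGS : CGSHowardDivisibilityPLocalized) : HowardContainmentLightFrameX10bPinned := by
  intro W _ _ p _ _ K _ _ hX hns hcm hKq hodd h3 hHN hHp hirr κ hκ γ hγ Dt H ιC _hc _hrk _hfin
  letI : Algebra K ℂ := ιC.toAlgebra
  let jbar : AlgebraicClosure K →+* ℂ :=
    (IsAlgClosed.lift (R := K) (M := ℂ) (S := AlgebraicClosure K)).toRingHom
  obtain ⟨D, F, X, hFDt, h⟩ := pinnedContainment_oddDisc_at_of_howard_kolyvaginSystem_mz_cgs hH hK hMZ hCGS hX hns hcm
    hKq hodd h3 hHN hHp hirr hκ hγ Dt H jbar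
  exact ⟨jbar, D, F, X, hFDt, h⟩

/-- **The deciding crux `HowardContainmentLightFrameX10bPinnedOfPrint` (stmt-BirchSwinnertonDyer-27275) BY NAME from `hH` and
`hK` alone** (`:= MZ → NV → CGS → Tw♯ → A-light`; of its own four binders only `hMZ` and `hCGS` are used — `hNV` and `hTw` are
idle). [cite: Howard2004HeegnerKolyvagin, Thm. 1.6.1] [cite: CastellaGrossiLeeSkinner2022, Thm. 4.1.1] -/
theorem howardContainmentLightFrameX10bPinnedOfPrint_of_howard_kolyvaginSystem
    (hH : HowardDVRKolyvaginBound) (hK : CGLSHeegnerKolyvaginSystem) : HowardContainmentLightFrameX10bPinnedOfPrint :=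
  fun hMZ _hNV hCGS _hTw ↦ howardContainmentLightFrameX10bPinned_of_howard_kolyvaginSystem_mz_cgs hH hK hMZ hCGS

/-! ## §3 The BROAD pinned aside 26621 restricted to odd `d_K` (any corank, any class number) -/

/-- **`HowardContainmentAnyClassNumberX10bPinned` (stmt-BirchSwinnertonDyer-26621, the PIN-1 twin of the write-crux 23729)
RESTRICTED TO ODD `d_K`, from `hH hK hMZ hCGS`**: the binders of 26621 VERBATIM followed by `Odd (NumberField.discr K)`,
then its TIED conclusion `∃ jbar D F X, F.Dt = Dt ∧ I(ℋ_∞(F))² ⊆ char_Λ(X_tors)` — ANY Selmer corank, ANY class number (no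
rank / `Ш` binder: they are idle in §1). (irr_K) is derived: (irr_ℚ) (`ClassX10`) + `(N_E, d_K) = 1` (from (Heeg)) + `3 ≠ 2`
give irreducibility over the quadratic `K` (Matar–Nekovář 2019 Prop. 5.26 (2), a tree theorem). The even-`d_K` half of 26621
at `3 ∣ h_K` has no printed source (CGLS 2022 §4.1 (disc)); its `3 ∤ h_K` half is MZ26 Cor. 4.6 (any parity).
[cite: MatarNekovar2019, Prop. 5.26 (2)] [cite: Howard2004HeegnerKolyvagin, Thm. 1.6.1] [cite: CastellaGrossiLeeSkinner2022, Thm. 4.1.1, §4.1 (disc)]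
[cite: CastellaGrossiSkinner2025, Thm. 6.5.2] [cite: MastellaZerman2026, Cor. 4.6] -/
theorem howardContainmentAnyClassNumberX10bPinned_oddDisc_of_howard_kolyvaginSystem_mz_cgs
    (hH : HowardDVRKolyvaginBound) (hK : CGLSHeegnerKolyvaginSystem) (hMZ : MastellaZermanHowardDivisibility)
    (hCGS : CGSHowardDivisibilityPLocalized) :
    ∀ (W : WeierstrassCurve ℚ) [W.IsElliptic] [W.IsGloballyMinimal] (p : ℕ) [Fact p.Prime]
      [NeZero (W.conductorNorm ℤ)] (K : Type) [Field K] [NumberField K],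
      ClassX10 W p → ¬ Surj W 3 → ¬ W.HasCM →
      IsImaginaryQuadratic K → NumberField.discr K ≠ -3 → NumberField.discr K ≠ -4 →
      SatisfiesHeegnerHypothesis (W.conductorNorm ℤ) K → SatisfiesHeegnerHypothesis p K →
      ∀ (κ : ZpExtension K p), κ.IsAnticyclotomic → ∀ (γ : Field.absoluteGaloisGroup K),
      κ.IsTopGenerator γ →
      ∀ (Dt : ModularParametrizationData W (W.conductorNorm ℤ))
        (H : HeegnerDatum (W.conductorNorm ℤ) (NumberField.discr K)) (ιC : K →+* ℂ),
      ¬ (p : ℤ) ∣ Dt.c → Odd (NumberField.discr K) →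
      ∃ (jbar : AlgebraicClosure K →+* ℂ) (D : (W.baseChange K).LambdaAdicSelmerData κ γ)
        (F : HeegnerFamily (W.conductorNorm ℤ) W K κ jbar) (X : (W.baseChange K).SelmerDualData κ γ),
        F.Dt = Dt ∧ heegnerCharIdeal D F ^ 2 ≤
          Module.charIdeal (IwasawaAlgebra p) (Submodule.torsion (IwasawaAlgebra p) X.X) := by
  intro W _ _ p _ _ K _ _ hX hns hcm hKq h3 _h4 hHN hHp κ hκ γ hγ Dt H ιC _hc hodd
  letI : Algebra K ℂ := ιC.toAlgebra
  let jbar : AlgebraicClosure K →+* ℂ :=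
    (IsAlgClosed.lift (R := K) (M := ℂ) (S := AlgebraicClosure K)).toRingHom
  -- (irr_K) from (irr_ℚ) on a Heegner frame (Matar–Nekovář Prop. 5.26 (2))
  have hirrQ : W.HasIrreducibleModPGaloisRep p := by
    obtain ⟨rfl, -⟩ := id hX
    exact hX.irr
  have hirr : (W.baseChange K).HasIrreducibleModPGaloisRep p :=
    MatarNekovar2019.hasIrreducibleModPGaloisRep_baseChange_of_coprime W K p hKq.1
      (Literature.SatisfiesHeegnerHypothesis.coprime_discr hKq.1 hHN) hX.ne_two hirrQ
  obtain ⟨D, F, X, hFDt, h⟩ := pinnedContainment_oddDisc_at_of_howard_kolyvaginSystem_mz_cgs hH hK hMZ hCGS hX hns hcm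
    hKq hodd h3 hHN hHp hirr hκ hγ Dt H jbar
  exact ⟨jbar, D, F, X, hFDt, h⟩

/-! ### Appended (x10b-p2 LEAD g11, 2026-08-29): the BROAD pinned aside 26621 BY NAME — census modulo its ONE residual -/

/-- **CENSUS OF stmt-BirchSwinnertonDyer-26621 `HowardContainmentAnyClassNumberX10bPinned` IN THE KERNEL** (the PIN-1 repaired
twin of the write-crux 23729): the item BY NAME from four cite-only `closes` binders — `HowardDVRKolyvaginBound` (23087),
`CGLSHeegnerKolyvaginSystem` (23236), `MastellaZermanHowardDivisibility` (25233), `CGSHowardDivisibilityPLocalized` (27112) — and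
ONE residual hypothesis `R_even^pin`: the item's own (tied) conclusion on the frames with `d_K` EVEN and `p ∣ h_K` (spelled out;
binders of 26621 verbatim + `¬ Odd (NumberField.discr K)` + `p ∣ NumberField.classNumber K`). Split: odd `d_K` ↦ §3 (any corank);
even `d_K`, `p ∤ h_K` ↦ `X10.heegnerContainmentPinned_of_cor46_of_not_surj` (MZ26 Cor. 4.6, no parity hypothesis); even `d_K`,
`p ∣ h_K` ↦ `R_even^pin` — NO printed source (CGLS 2022 §4.1 (disc) inherited by CGS 2025 Thm. 6.5.2; Howard / MZ26 / BCK21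
assume `p ∤ h_K`), vacuous for even-conductor curves. So of the two «sourceless regimes» for which 26621 was set aside (corank
`≠ 1`; even `d_K` at `3 ∣ h_K`) the FIRST is discharged (Thm. 6.5.2 + the strengthened coherent-pair letter need no rank binder)
and only the second remains. CONDITIONAL; credits nothing by itself.
[cite: Howard2004HeegnerKolyvagin, Thm. 1.6.1] [cite: CastellaGrossiLeeSkinner2022, Thm. 4.1.1, §4.1 (disc) (arXiv:2008.02571v2 TeX L248–249)]
[cite: CastellaGrossiSkinner2025, Thm. 6.5.2] [cite: MastellaZerman2026, Cor. 4.6] [cite: MatarNekovar2019, Prop. 5.26 (2)] -/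
theorem howardContainmentAnyClassNumberX10bPinned_of_printLeaves_of_evenDiscResidual
    (hH : HowardDVRKolyvaginBound) (hK : CGLSHeegnerKolyvaginSystem) (hMZ : MastellaZermanHowardDivisibility)
    (hCGS : CGSHowardDivisibilityPLocalized)
    (hEven : ∀ (W : WeierstrassCurve ℚ) [W.IsElliptic] [W.IsGloballyMinimal] (p : ℕ) [Fact p.Prime]
      [NeZero (W.conductorNorm ℤ)] (K : Type) [Field K] [NumberField K],
      ClassX10 W p → ¬ Surj W 3 → ¬ W.HasCM →
      IsImaginaryQuadratic K → NumberField.discr K ≠ -3 → NumberField.discr K ≠ -4 →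
      SatisfiesHeegnerHypothesis (W.conductorNorm ℤ) K → SatisfiesHeegnerHypothesis p K →
      ∀ (κ : ZpExtension K p), κ.IsAnticyclotomic → ∀ (γ : Field.absoluteGaloisGroup K),
      κ.IsTopGenerator γ →
      ∀ (Dt : ModularParametrizationData W (W.conductorNorm ℤ))
        (H : HeegnerDatum (W.conductorNorm ℤ) (NumberField.discr K)) (ιC : K →+* ℂ),
      ¬ (p : ℤ) ∣ Dt.c → ¬ Odd (NumberField.discr K) → p ∣ NumberField.classNumber K →
      ∃ (jbar : AlgebraicClosure K →+* ℂ) (D : (W.baseChange K).LambdaAdicSelmerData κ γ)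
        (F : HeegnerFamily (W.conductorNorm ℤ) W K κ jbar) (X : (W.baseChange K).SelmerDualData κ γ),
        F.Dt = Dt ∧ heegnerCharIdeal D F ^ 2 ≤
          Module.charIdeal (IwasawaAlgebra p) (Submodule.torsion (IwasawaAlgebra p) X.X)) :
    HowardContainmentAnyClassNumberX10bPinned := by
  intro W _ _ p _ _ K _ _ hX hns hcm hKq h3 h4 hHN hHp κ hκ γ hγ Dt H ιC hc
  by_cases hodd : Odd (NumberField.discr K)
  · exact howardContainmentAnyClassNumberX10bPinned_oddDisc_of_howard_kolyvaginSystem_mz_cgs hH hK hMZ hCGS W p K hX hns hcm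
      hKq h3 h4 hHN hHp κ hκ γ hγ Dt H ιC hc hodd
  · by_cases hhK : p ∣ NumberField.classNumber K
    · exact hEven W p K hX hns hcm hKq h3 h4 hHN hHp κ hκ γ hγ Dt H ιC hc hodd hhK
    · letI : Algebra K ℂ := ιC.toAlgebra
      let jbar : AlgebraicClosure K →+* ℂ :=
        (IsAlgClosed.lift (R := K) (M := ℂ) (S := AlgebraicClosure K)).toRingHom
      have h46 : MastellaZerman2026.cor46_howardDivisibility_of_scalarImage.{0} := hMZ
      obtain ⟨D, F, X, hFD, -, hle⟩ :=
        Summit.BirchSwinnertonDyer.BirchSwinnertonDyer.Rank1Residual.X10.heegnerContainmentPinned_of_cor46_of_not_surj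
          h46 hX hns hcm hKq h3 h4 hHN hHp hhK κ hκ γ hγ Dt H jbar
      exact ⟨jbar, D, F, X, hFD, hle⟩

end Summit.BirchSwinnertonDyer.BirchSwinnertonDyer.Theorems.PrintX10bOfKSLeaf

end
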